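import Literature.NumberTheory.Rogawski1990.LocalTransferChartJunctionCM             -- ★ p840735 F0P2-p02 (g8): transport bookkeeping `isLocalNormPair_symm_of_transport` + the whole local currency
import Literature.NumberTheory.Rogawski1990.FinExplicitTransferFactorEventuallyConst       -- ★ B-p04: `finExplicitDelta_eventually_eq` (eventual constancy of `Δ‴_v` at a matched pair)
import Literature.NumberTheory.Automorphic.LocalStableOrbitalFinite                      -- ★ `stableOrbitalIntegralRel_smul_fun`
import HarnessLib

/-!
# THE CENTRAL SINGULAR JUNCTION AT THE CM CARRIERS — `R_φ` is a local stable orbital integral at `ε_H = (a·1₂, u)`, `u ≠ a`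
# (Rogawski 1990 Prop. 8.2.1 (a)(d) ⟸ 8.1.3; Langlands–Shelstad descent Thm. 2.3.A, §2.4), HYPOTHESIS-DRIVEN on the descent data

Topic `NumberTheory/Rogawski1990`; namespace `Literature.NumberTheory.Rogawski1990`.  TWO THEOREMS + private bookkeeping (no definition, no instance, no notation, no named fact,
no `sorry`).  Cell `pub/hodgecm-mathlib` (D-0151), crux H413 = stmt-HodgeConjecture-24833, floor-2 line «N6nsGerm» (`Cruxes/H413/Lines/F0_P3a_N6nsGerm.lean`, stub `stub_N6nsS1`),
LEAD F0P3a-plan (g9) WORD T8-63 (B) «(α′) (D2) DESCENT CONSUMER»; seat F0P2-p02 (g8) (pen of the line).  HONEST LABEL: HC_CM is proved only modulo the printed citations until rung 0 closes;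
this file proves `stub_N6nsS1` ONLY MODULO ITS BINDERS (the central dock (T-s′), the transported separation (SEP′) and side-disjointness, the SIDED uniform fibre (U-s′), the DESCENT of
orbital integrals at `ε` with canonical families (D2ε), SATURATION at `ε_H` (σ-SAT), and «the `ε′`-side is a local stable orbital integral» (Iε′) = (D2ε′)+(C-an)+(K-s)+(R2)).

THE MATHEMATICS.  `ε_H = (a·1₂, u) ∈ H_v = U(Φ₂)_v × U(Φ₁)_v` is central in `H_v` and `(G,H)`-regular (`u ≠ a`); its norm class in `G′_v = U(H′)(L⁺_v)` is a STABLE class with two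
`G′_v`-classes `ε` (centraliser `≅ H_v`, «good») and `ε′` (centraliser `U(2)_an × L¹_w`, compact).  For `γ_H` `G`-regular near `ε_H`,
`R_φ(γ_H) = Σ_c Δ‴_v(γ_H, c)·Φ(c, φ)` splits by the SIDED uniform fibre into the classes through a small box around `ε` inside `Z_{G′}(ε) = θ(H_v)` and those through a
box around `ε′`; on the `ε`-side `Δ‴_v(γ_H, c) = Δ‴_v(ε_H, ε)` (★ `finExplicitDelta_eventually_eq`, `χ_{a·1₂}(u) = (u − a)²` a unit) and the DESCENT turns `Φ(c, φ)` into
`H_v`-orbital integrals of `φ_ε`, whose sum over the classes is the FULL stable orbital integral `Φ^st_H(γ_H, φ_ε)` by SATURATION at `ε_H` (every class of the stable class of `γ_H`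
meets the box) and the transported separation (SEP′: classes through the box ↔ `H_v`-classes injectively); the `ε′`-side is a local stable orbital integral by (Iε′).  Additivity ★
`localStableOrbitalIntegralH_add_of_isLocSmooth` sums the two sides.  [Rogawski1990 §8.1 Prop. 8.1.3 pp. 110–111, §8.2 Prop. 8.2.1 (a)(d) p. 112; LanglandsShelstad1990Descent §2.3–2.4.]

## References
* [Rogawski1990] J. Rogawski, *Automorphic Representations of Unitary Groups in Three Variables*, Ann. of Math. Stud. 123 (1990): §8.1 Props. 8.1.1–8.1.4 pp. 106–111; §8.2 Prop. 8.2.1 pp. 112–116; §4.3 (4.3.1) p. 43; §3.8 Prop. 3.8.1 (d) p. 30.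
* [LanglandsShelstad1990Descent] R. P. Langlands, D. Shelstad, *Descent for transfer factors*, The Grothendieck Festschrift II (1990): §2.3 Thm. 2.3.A, §2.4.
* [LanglandsShelstad1983PV] R. P. Langlands, D. Shelstad, *On principal values on p-adic manifolds*, LNM 1041 (1984): Lemma 4.B (the rank-one input (R2), a binder here).
-/

set_option autoImplicit false

noncomputable section

open Set Filter Topology MeasureTheory Polynomial
open scoped Pointwise Matrix

namespace Literature.NumberTheory.Rogawski1990

open Literature.NumberTheory.Automorphic Literature.NumberTheory.Automorphic.UnitaryGroup Literature.NumberTheory.GaloisRepresentations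
open _root_.NumberField _root_.IsDedekindDomain

section CentralSingular

variable (L : Type) [Field L] [NumberField L] [IsCMField L] (H' : Matrix (Fin 3) (Fin 3) L) (v : HeightOneSpectrum (𝓞 ↥(maximalRealSubfield L)))

/-! ## §1 Bookkeeping -/

/-- `χ_{a·1₂}(u) = (u − a)²` is a UNIT when `u ≠ a` and there is one place of `L` above `v` (so `∏_{w ∣ v} L_w` is a field).  The `hu₀` input of ★
`finExplicitDelta_eventually_eq` at the central point `ε_H = (a·1₂, u)`. [cite: Rogawski1990, §4.9 p. 55; §8.2 Prop. 8.2.1 (a) p. 112] -/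
theorem isUnit_eval_finCharpolyTwo_of_central (w : PlacesOver L v) (hw : IsCMField.complexConj L • w.1 = w.1)
    (εH : ((cmDatum L 2 (Matrix.of fun i j : Fin 2 => if i.val + j.val + 1 = 2 then (1 : L) else 0)).Local v ×
      (cmDatum L 1 (Matrix.of fun i j : Fin 1 => if i.val + j.val + 1 = 1 then (1 : L) else 0)).Local v)) (a : LocalRing L v)
    (ha : (εH.1.val.val : Matrix (Fin 2) (Fin 2) (LocalRing L v)) = a • (1 : Matrix (Fin 2) (Fin 2) (LocalRing L v)))
    (hu : (εH.2.val.val : Matrix (Fin 1) (Fin 1) (LocalRing L v)) 0 0 ≠ a) :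
    IsUnit ((finCharpolyTwo L v εH).eval (finGammaTwo L v εH)) := by
  haveI := PlacesOver.subsingleton_of_smul_eq (IsCMField.complexConj L) (IsCMField.complexConj_ne_one L) w hw
  have hsub : IsUnit (finGammaTwo L v εH - a) := by
    rw [Pi.isUnit_iff]
    intro w'
    rw [isUnit_iff_ne_zero, Pi.sub_apply, sub_ne_zero]
    intro h
    apply hu
    funext w''
    rw [Subsingleton.elim w'' w']
    exact h
  have hχ : finCharpolyTwo L v εH = (X - C a) ^ 2 := by
    rw [finCharpolyTwo, ha, Matrix.smul_one_eq_diagonal, Matrix.charpoly_diagonal, Finset.prod_const, Finset.card_univ, Fintype.card_fin]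
  rw [hχ, eval_pow, eval_sub, eval_X, eval_C]
  exact hsub.pow 2

/-- `⟦out c⟧ = c` for conjugacy classes. [folklore] -/
private theorem conjClasses_mk_quotient_out {G : Type*} [Monoid G] (c : ConjClasses G) : ConjClasses.mk (Quotient.out c) = c := by
  rw [← ConjClasses.quotient_mk_eq_mk, Quotient.out_eq]

/-- **Orbital integrals only see the class**: `⟦x·g·x⁻¹⟧ = ⟦g⟧`. [folklore] -/
private theorem conjClasses_mk_conj_eq {G : Type*} [Group G] (x g : G) : ConjClasses.mk (x * g * x⁻¹) = ConjClasses.mk g :=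
  (ConjClasses.mk_eq_mk_iff_isConj.2 (isConj_iff.2 ⟨x, rfl⟩)).symm

/-- A representative of `⟦g⟧` is conjugate to `g` (stated over a `Group` so that the instance path is the ambient one). [folklore] -/
private theorem isConj_quotient_out_conjClassesMk {G : Type*} [Group G] (g : G) : IsConj g (Quotient.out (ConjClasses.mk g)) :=
  ConjClasses.mk_eq_mk_iff_isConj.1 (conjClasses_mk_quotient_out (ConjClasses.mk g)).symm

/-- A class-respecting relation holds at the chosen representative of `⟦a⟧` once it holds at `a` (instance-path-stable packaging over a `Group`). [folklore] -/
private theorem rel_quotient_out_conjClassesMk {G : Type*} [Group G] {st : G → G → Prop}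
    (hconj : ∀ a x : G, st a (x * a * x⁻¹)) (htrans : ∀ a b c : G, st a b → st b c → st a c)
    {γ a : G} (h : st γ a) : st γ (Quotient.out (ConjClasses.mk a)) := by
  obtain ⟨c, hc⟩ := isConj_iff.1 (isConj_quotient_out_conjClassesMk a)
  rw [← hc]
  exact htrans _ _ _ h (hconj a c)

/-! ## §2 The central singular junction -/

variable [iM' : ∀ γ : (cmDatum L 3 H').Local v, MeasurableSpace ((cmDatum L 3 H').Local v ⧸ Subgroup.centralizer ({γ} : Set ((cmDatum L 3 H').Local v)))]
  [iH : ∀ a : ((cmDatum L 2 (Matrix.of fun i j : Fin 2 => if i.val + j.val + 1 = 2 then (1 : L) else 0)).Local v ×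
      (cmDatum L 1 (Matrix.of fun i j : Fin 1 => if i.val + j.val + 1 = 1 then (1 : L) else 0)).Local v), MeasurableSpace (((cmDatum L 2 (Matrix.of fun i j : Fin 2 => if i.val + j.val + 1 = 2 then (1 : L) else 0)).Local v ×
      (cmDatum L 1 (Matrix.of fun i j : Fin 1 => if i.val + j.val + 1 = 1 then (1 : L) else 0)).Local v) ⧸ Subgroup.centralizer ({a} : Set ((cmDatum L 2 (Matrix.of fun i j : Fin 2 => if i.val + j.val + 1 = 2 then (1 : L) else 0)).Local v ×
      (cmDatum L 1 (Matrix.of fun i j : Fin 1 => if i.val + j.val + 1 = 1 then (1 : L) else 0)).Local v)))]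

set_option maxHeartbeats 400000 in
/-- **THE ε-SIDE SUM** (bookkeeping of LS-Descent §2.4 at the good class).  For a `G`-regular `γ_H`, a box `B ⊆ H_v` such that (i) every element
stably conjugate to `γ_H` is `H_v`-conjugate into `B` (saturation), (ii) `G′_v`-conjugate `θ`-images of box points are `H_v`-conjugate (SEP′), (iii) `Δ_v(γ_H, θ h) = Δ₀` and
(iv) `Φ(⟦θ h⟧, φ; mG) = Φ(⟦h⟧, φ_ε; mH)` at the box points stably conjugate to `γ_H` (eventual constancy of `Δ‴`, descent): the part of `Σ_c Δ_v(γ_H, c)·Φ(c, φ)` over the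
classes conjugate into `θ(B)` at a point stably conjugate to `γ_H` equals `Δ₀ · Φ^st_H(γ_H, φ_ε)` — via the bijection `d ↦ ⟦θ(out d)⟧` from the `H_v`-classes of the stable
class of `γ_H` (Mathlib `finsum_mem_eq_of_bijOn`). [cite: Rogawski1990, §8.1 Prop. 8.1.3 pp. 110–111; §4.3 (4.3.1) p. 43] [cite: LanglandsShelstad1990Descent, §2.4] -/
theorem finsum_mem_side_eq_mul_stableOrbitalIntegralRel (μ : HeckeCharacter L)
    (hl : ∀ (v : HeightOneSpectrum (𝓞 ↥(maximalRealSubfield L))) (a : ((cmDatum L 2 (Matrix.of fun i j : Fin 2 => if i.val + j.val + 1 = 2 then (1 : L) else 0)).Local v ×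
      (cmDatum L 1 (Matrix.of fun i j : Fin 1 => if i.val + j.val + 1 = 1 then (1 : L) else 0)).Local v)) (b : (cmDatum L 3 H').Local v) (x : ((cmDatum L 2 (Matrix.of fun i j : Fin 2 => if i.val + j.val + 1 = 2 then (1 : L) else 0)).Local v ×
      (cmDatum L 1 (Matrix.of fun i j : Fin 1 => if i.val + j.val + 1 = 1 then (1 : L) else 0)).Local v)),
      finExplicitDelta L v H' (x * a * x⁻¹) μ b = finExplicitDelta L v H' a μ b)
    (hr : ∀ (v : HeightOneSpectrum (𝓞 ↥(maximalRealSubfield L))) (a : ((cmDatum L 2 (Matrix.of fun i j : Fin 2 => if i.val + j.val + 1 = 2 then (1 : L) else 0)).Local v ×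
      (cmDatum L 1 (Matrix.of fun i j : Fin 1 => if i.val + j.val + 1 = 1 then (1 : L) else 0)).Local v)) (b y : (cmDatum L 3 H').Local v),
      finExplicitDelta L v H' a μ (y * b * y⁻¹) = finExplicitDelta L v H' a μ b)
    (mH : OrbitalMeasureFamily ((cmDatum L 2 (Matrix.of fun i j : Fin 2 => if i.val + j.val + 1 = 2 then (1 : L) else 0)).Local v ×
      (cmDatum L 1 (Matrix.of fun i j : Fin 1 => if i.val + j.val + 1 = 1 then (1 : L) else 0)).Local v)) (mG : OrbitalMeasureFamily ((cmDatum L 3 H').Local v))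
    {ε : (cmDatum L 3 H').Local v} (θ : ((cmDatum L 2 (Matrix.of fun i j : Fin 2 => if i.val + j.val + 1 = 2 then (1 : L) else 0)).Local v ×
      (cmDatum L 1 (Matrix.of fun i j : Fin 1 => if i.val + j.val + 1 = 1 then (1 : L) else 0)).Local v) ≃ₜ* ↥(Subgroup.centralizer ({ε} : Set ((cmDatum L 3 H').Local v)))) (γH : ((cmDatum L 2 (Matrix.of fun i j : Fin 2 => if i.val + j.val + 1 = 2 then (1 : L) else 0)).Local v ×
      (cmDatum L 1 (Matrix.of fun i j : Fin 1 => if i.val + j.val + 1 = 1 then (1 : L) else 0)).Local v)) (B : Set ((cmDatum L 2 (Matrix.of fun i j : Fin 2 => if i.val + j.val + 1 = 2 then (1 : L) else 0)).Local v ×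
      (cmDatum L 1 (Matrix.of fun i j : Fin 1 => if i.val + j.val + 1 = 1 then (1 : L) else 0)).Local v))
    (φ : (cmDatum L 3 H').Local v → ℂ) (φε : ((cmDatum L 2 (Matrix.of fun i j : Fin 2 => if i.val + j.val + 1 = 2 then (1 : L) else 0)).Local v ×
      (cmDatum L 1 (Matrix.of fun i j : Fin 1 => if i.val + j.val + 1 = 1 then (1 : L) else 0)).Local v) → ℂ) (Δ₀ : ℂ)
    (hsatB : ∀ γH' : ((cmDatum L 2 (Matrix.of fun i j : Fin 2 => if i.val + j.val + 1 = 2 then (1 : L) else 0)).Local v ×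
      (cmDatum L 1 (Matrix.of fun i j : Fin 1 => if i.val + j.val + 1 = 1 then (1 : L) else 0)).Local v), IsLocalStablyConjH L v γH γH' → ∃ x : ((cmDatum L 2 (Matrix.of fun i j : Fin 2 => if i.val + j.val + 1 = 2 then (1 : L) else 0)).Local v ×
      (cmDatum L 1 (Matrix.of fun i j : Fin 1 => if i.val + j.val + 1 = 1 then (1 : L) else 0)).Local v), x * γH' * x⁻¹ ∈ B)
    (hsepB : ∀ h ∈ B, ∀ h' ∈ B, ∀ x : (cmDatum L 3 H').Local v, x * ((θ h : ↥(Subgroup.centralizer ({ε} : Set ((cmDatum L 3 H').Local v)))) : (cmDatum L 3 H').Local v) * x⁻¹ = ((θ h' : ↥(Subgroup.centralizer ({ε} : Set ((cmDatum L 3 H').Local v)))) : (cmDatum L 3 H').Local v) → IsConj h h')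
    (hΔB : ∀ h ∈ B, IsLocalStablyConjH L v γH h → finExplicitDelta L v H' γH μ ((θ h : ↥(Subgroup.centralizer ({ε} : Set ((cmDatum L 3 H').Local v)))) : (cmDatum L 3 H').Local v) = Δ₀)
    (hdescB : ∀ h ∈ B, IsLocalStablyConjH L v γH h →
      classOrbitalIntegral mG φ (ConjClasses.mk ((θ h : ↥(Subgroup.centralizer ({ε} : Set ((cmDatum L 3 H').Local v)))) : (cmDatum L 3 H').Local v)) = classOrbitalIntegral mH φε (ConjClasses.mk h)) :
    (∑ᶠ c ∈ {c : ConjClasses ((cmDatum L 3 H').Local v) | ∃ x : (cmDatum L 3 H').Local v, ∃ h ∈ B, IsLocalStablyConjH L v γH h ∧ x * Quotient.out c * x⁻¹ = ((θ h : ↥(Subgroup.centralizer ({ε} : Set ((cmDatum L 3 H').Local v)))) : (cmDatum L 3 H').Local v)},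
        ((finExplicitCollection L H' μ hl hr) v).Δ γH (Quotient.out c) * classOrbitalIntegral mG φ c) =
      Δ₀ * stableOrbitalIntegralRel (IsLocalStablyConjH L v) mH φε γH := by
  classical
  have hθconj : ∀ z h : ((cmDatum L 2 (Matrix.of fun i j : Fin 2 => if i.val + j.val + 1 = 2 then (1 : L) else 0)).Local v ×
      (cmDatum L 1 (Matrix.of fun i j : Fin 1 => if i.val + j.val + 1 = 1 then (1 : L) else 0)).Local v), ((θ (z * h * z⁻¹) : ↥(Subgroup.centralizer ({ε} : Set ((cmDatum L 3 H').Local v)))) : (cmDatum L 3 H').Local v) =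
      ((θ z : ↥(Subgroup.centralizer ({ε} : Set ((cmDatum L 3 H').Local v)))) : (cmDatum L 3 H').Local v) * ((θ h : ↥(Subgroup.centralizer ({ε} : Set ((cmDatum L 3 H').Local v)))) : (cmDatum L 3 H').Local v) * ((θ z : ↥(Subgroup.centralizer ({ε} : Set ((cmDatum L 3 H').Local v)))) : (cmDatum L 3 H').Local v)⁻¹ := by
    intro z h
    rw [map_mul, map_mul, map_inv, Subgroup.coe_mul, Subgroup.coe_mul, Subgroup.coe_inv]
  -- every class of the stable class of `γ_H` has a representative in `B`, read through `θ`
  have key : ∀ d ∈ {d : ConjClasses ((cmDatum L 2 (Matrix.of fun i j : Fin 2 => if i.val + j.val + 1 = 2 then (1 : L) else 0)).Local v ×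
      (cmDatum L 1 (Matrix.of fun i j : Fin 1 => if i.val + j.val + 1 = 1 then (1 : L) else 0)).Local v) | IsLocalStablyConjH L v γH (Quotient.out d)},
      ∃ h ∈ B, IsLocalStablyConjH L v γH h ∧ ConjClasses.mk h = d ∧
        ConjClasses.mk ((θ h : ↥(Subgroup.centralizer ({ε} : Set ((cmDatum L 3 H').Local v)))) : (cmDatum L 3 H').Local v) = ConjClasses.mk ((θ (Quotient.out d) : ↥(Subgroup.centralizer ({ε} : Set ((cmDatum L 3 H').Local v)))) : (cmDatum L 3 H').Local v) := by
    intro d hd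
    obtain ⟨z, hzB⟩ := hsatB _ hd
    refine ⟨z * Quotient.out d * z⁻¹, hzB, IsStablyConjH.trans hd (isStablyConjH_of_isConj (isConj_iff.2 ⟨z, rfl⟩)), ?_, ?_⟩
    · rw [conjClasses_mk_conj_eq, conjClasses_mk_quotient_out]
    · rw [hθconj, conjClasses_mk_conj_eq]
  have hPεθ : ∀ h ∈ B, IsLocalStablyConjH L v γH h →
      ∃ x : (cmDatum L 3 H').Local v, ∃ h' ∈ B, IsLocalStablyConjH L v γH h' ∧
        x * Quotient.out (ConjClasses.mk ((θ h : ↥(Subgroup.centralizer ({ε} : Set ((cmDatum L 3 H').Local v)))) : (cmDatum L 3 H').Local v)) * x⁻¹ = ((θ h' : ↥(Subgroup.centralizer ({ε} : Set ((cmDatum L 3 H').Local v)))) : (cmDatum L 3 H').Local v) := by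
    intro h hhB hst
    obtain ⟨x, hx⟩ := isConj_iff.1 (isConj_quotient_out_conjClassesMk ((θ h : ↥(Subgroup.centralizer ({ε} : Set ((cmDatum L 3 H').Local v)))) : (cmDatum L 3 H').Local v)).symm
    exact ⟨x, h, hhB, hst, hx⟩
  rw [stableOrbitalIntegralRel_def, mul_finsum_mem]
  symm
  refine finsum_mem_eq_of_bijOn (fun d : ConjClasses ((cmDatum L 2 (Matrix.of fun i j : Fin 2 => if i.val + j.val + 1 = 2 then (1 : L) else 0)).Local v ×
      (cmDatum L 1 (Matrix.of fun i j : Fin 1 => if i.val + j.val + 1 = 1 then (1 : L) else 0)).Local v) => ConjClasses.mk ((θ (Quotient.out d) : ↥(Subgroup.centralizer ({ε} : Set ((cmDatum L 3 H').Local v)))) : (cmDatum L 3 H').Local v)) ⟨?_, ?_, ?_⟩ ?_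
  · -- maps the stable class of `γ_H` into the ε-side classes
    intro d hd
    obtain ⟨h, hhB, hst, -, hθh⟩ := key d hd
    simp only [Set.mem_setOf_eq]
    rw [← hθh]
    exact hPεθ h hhB hst
  · -- injective there (SEP′)
    intro d₁ hd₁ d₂ hd₂ h12
    obtain ⟨h₁, hh₁B, -, hh₁d, hθh₁⟩ := key d₁ hd₁
    obtain ⟨h₂, hh₂B, -, hh₂d, hθh₂⟩ := key d₂ hd₂
    have h12' : ConjClasses.mk ((θ h₁ : ↥(Subgroup.centralizer ({ε} : Set ((cmDatum L 3 H').Local v)))) : (cmDatum L 3 H').Local v) = ConjClasses.mk ((θ h₂ : ↥(Subgroup.centralizer ({ε} : Set ((cmDatum L 3 H').Local v)))) : (cmDatum L 3 H').Local v) := by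
      rw [hθh₁, hθh₂]; exact h12
    obtain ⟨x, hx⟩ := isConj_iff.1 (ConjClasses.mk_eq_mk_iff_isConj.1 h12')
    rw [← hh₁d, ← hh₂d]
    exact ConjClasses.mk_eq_mk_iff_isConj.2 (hsepB h₁ hh₁B h₂ hh₂B x hx)
  · -- onto the ε-side classes
    intro c hc
    obtain ⟨x, h, hhB, hst, hx⟩ := hc
    obtain ⟨z, hz⟩ := isConj_iff.1 (isConj_quotient_out_conjClassesMk h)
    refine ⟨ConjClasses.mk h, ?_, ?_⟩
    · simp only [Set.mem_setOf_eq]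
      exact rel_quotient_out_conjClassesMk (st := IsLocalStablyConjH L v) (fun a x => isStablyConjH_of_isConj (isConj_iff.2 ⟨x, rfl⟩))
        (fun _ _ _ h₁ h₂ => IsStablyConjH.trans h₁ h₂) hst
    · beta_reduce
      rw [← hz, hθconj, conjClasses_mk_conj_eq, ← hx, conjClasses_mk_conj_eq, conjClasses_mk_quotient_out]
  · -- termwise: `Δ₀ · Φ(⟦h⟧, φ_ε; mH) = Δ(γ_H, ⟦θ h⟧) · Φ(⟦θ h⟧, φ; mG)`
    intro d hd
    obtain ⟨h, hhB, hst, hhd, hθh⟩ := key d hd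
    rw [← hθh]
    obtain ⟨x, hx⟩ := isConj_iff.1 (isConj_quotient_out_conjClassesMk ((θ h : ↥(Subgroup.centralizer ({ε} : Set ((cmDatum L 3 H').Local v)))) : (cmDatum L 3 H').Local v)).symm
    rw [finExplicitCollection_Δ, ← hr v γH _ x, hx, hΔB h hhB hst, hdescB h hhB hst, hhd]

variable [MeasurableSpace ((cmDatum L 2 (Matrix.of fun i j : Fin 2 => if i.val + j.val + 1 = 2 then (1 : L) else 0)).Local v ×
      (cmDatum L 1 (Matrix.of fun i j : Fin 1 => if i.val + j.val + 1 = 1 then (1 : L) else 0)).Local v)] [BorelSpace ((cmDatum L 2 (Matrix.of fun i j : Fin 2 => if i.val + j.val + 1 = 2 then (1 : L) else 0)).Local v ×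
      (cmDatum L 1 (Matrix.of fun i j : Fin 1 => if i.val + j.val + 1 = 1 then (1 : L) else 0)).Local v)]
  [iHB : ∀ a : ((cmDatum L 2 (Matrix.of fun i j : Fin 2 => if i.val + j.val + 1 = 2 then (1 : L) else 0)).Local v ×
      (cmDatum L 1 (Matrix.of fun i j : Fin 1 => if i.val + j.val + 1 = 1 then (1 : L) else 0)).Local v), BorelSpace (((cmDatum L 2 (Matrix.of fun i j : Fin 2 => if i.val + j.val + 1 = 2 then (1 : L) else 0)).Local v ×
      (cmDatum L 1 (Matrix.of fun i j : Fin 1 => if i.val + j.val + 1 = 1 then (1 : L) else 0)).Local v) ⧸ Subgroup.centralizer ({a} : Set ((cmDatum L 2 (Matrix.of fun i j : Fin 2 => if i.val + j.val + 1 = 2 then (1 : L) else 0)).Local v ×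
      (cmDatum L 1 (Matrix.of fun i j : Fin 1 => if i.val + j.val + 1 = 1 then (1 : L) else 0)).Local v)))]

/-- **`R_φ` IS A LOCAL STABLE ORBITAL INTEGRAL AT A CENTRAL `(G,H)`-REGULAR POINT `ε_H = (a·1₂, u)`, `u ≠ a` — the body of `stub_N6nsS1`, HYPOTHESIS-DRIVEN on the descent data
(Rogawski 1990 Prop. 8.2.1 (a)(d); Langlands–Shelstad descent Thm. 2.3.A / §2.4).**  Data (`v` non-split, explicit `Δ_v`, canonical `mH`): the central point `ε_H` (`ha`, `hu`); the
CENTRAL DOCK (T-s′) `θ : H_v ≃ₜ* Z_{G′_v}(ε)`, `(θ z) = y·ι(z)·y⁻¹`, `y·ι(ε_H)·y⁻¹ = ε` (the «good» class); the «bad» class base point `ε̂′ ∈ Z_{G′_v}(ε′)`; the binders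
`hsep′` (SEP′ transported: `G′_v`-conjugate images of box points are `H_v`-conjugate), `hdisj` (small boxes on the two sides share no class), `hUs` (SIDED UNIFORM FIBRE: near `ε_H`
every matched `γ′` is conjugate into `θ(B)` at a point STABLY CONJUGATE to `γ_H`, or into `B′`), `hD` (DESCENT at `ε`: `Φ(⟦θ h⟧, ψ; mG) = Φ(⟦h⟧, ψ_ε; mH)` for `h` in a box, `ψ_ε ∈ C_c^∞(H_v)`),
`hsat` (SATURATION at `ε_H`), `hI′` (the `ε′`-side is a local stable orbital integral, box shrinkable).  CONCLUSION: `∃ V ∈ 𝓝 ε_H, ∃ φ^H ∈ C_c^∞(H_v), ∀ γ_H ∈ V` `G`-regular,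
`Φ^st_H(γ_H, φ^H) = Σᶠ_c Δ_v(γ_H, c)·Φ(c, φ)` — `stub_N6nsS1`'s body at `T := (finExplicitCollection μ) v`.
[cite: Rogawski1990, §8.2 Prop. 8.2.1 (a)(d) p. 112; §8.1 Prop. 8.1.3 pp. 110–111; §4.3 (4.3.1) p. 43] [cite: LanglandsShelstad1990Descent, Thm. 2.3.A, §2.4] -/
theorem exists_nhds_stableOrbitalIntegralRel_eq_of_central_singular (w : PlacesOver L v) (hw : IsCMField.complexConj L • w.1 = w.1)
    (hH' : (H'.map (cmConjRingHom L))ᵀ = H') (hdet' : H'.det ≠ 0) (μ : HeckeCharacter L)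
    (hl : ∀ (v : HeightOneSpectrum (𝓞 ↥(maximalRealSubfield L))) (a : ((cmDatum L 2 (Matrix.of fun i j : Fin 2 => if i.val + j.val + 1 = 2 then (1 : L) else 0)).Local v ×
      (cmDatum L 1 (Matrix.of fun i j : Fin 1 => if i.val + j.val + 1 = 1 then (1 : L) else 0)).Local v)) (b : (cmDatum L 3 H').Local v) (x : ((cmDatum L 2 (Matrix.of fun i j : Fin 2 => if i.val + j.val + 1 = 2 then (1 : L) else 0)).Local v ×
      (cmDatum L 1 (Matrix.of fun i j : Fin 1 => if i.val + j.val + 1 = 1 then (1 : L) else 0)).Local v)),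
      finExplicitDelta L v H' (x * a * x⁻¹) μ b = finExplicitDelta L v H' a μ b)
    (hr : ∀ (v : HeightOneSpectrum (𝓞 ↥(maximalRealSubfield L))) (a : ((cmDatum L 2 (Matrix.of fun i j : Fin 2 => if i.val + j.val + 1 = 2 then (1 : L) else 0)).Local v ×
      (cmDatum L 1 (Matrix.of fun i j : Fin 1 => if i.val + j.val + 1 = 1 then (1 : L) else 0)).Local v)) (b y : (cmDatum L 3 H').Local v),
      finExplicitDelta L v H' a μ (y * b * y⁻¹) = finExplicitDelta L v H' a μ b)
    (νH : Measure ((cmDatum L 2 (Matrix.of fun i j : Fin 2 => if i.val + j.val + 1 = 2 then (1 : L) else 0)).Local v ×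
      (cmDatum L 1 (Matrix.of fun i j : Fin 1 => if i.val + j.val + 1 = 1 then (1 : L) else 0)).Local v)) [νH.IsHaarMeasure] [νH.IsMulRightInvariant]
    {mH : OrbitalMeasureFamily ((cmDatum L 2 (Matrix.of fun i j : Fin 2 => if i.val + j.val + 1 = 2 then (1 : L) else 0)).Local v ×
      (cmDatum L 1 (Matrix.of fun i j : Fin 1 => if i.val + j.val + 1 = 1 then (1 : L) else 0)).Local v)} {mG : OrbitalMeasureFamily ((cmDatum L 3 H').Local v)}
    (hmH : mH.IsCanonical (IsLocalGRegular L v) νH)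
    -- the central `(G,H)`-regular point
    (εH : ((cmDatum L 2 (Matrix.of fun i j : Fin 2 => if i.val + j.val + 1 = 2 then (1 : L) else 0)).Local v ×
      (cmDatum L 1 (Matrix.of fun i j : Fin 1 => if i.val + j.val + 1 = 1 then (1 : L) else 0)).Local v)) (a : LocalRing L v)
    (ha : (εH.1.val.val : Matrix (Fin 2) (Fin 2) (LocalRing L v)) = a • (1 : Matrix (Fin 2) (Fin 2) (LocalRing L v)))
    (hu : (εH.2.val.val : Matrix (Fin 1) (Fin 1) (LocalRing L v)) 0 0 ≠ a)
    -- (T-s′) the central dock at the good class `ε`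
    (ε : (cmDatum L 3 H').Local v) (y : GL (Fin 3) (LocalRing L v)) (θ : ((cmDatum L 2 (Matrix.of fun i j : Fin 2 => if i.val + j.val + 1 = 2 then (1 : L) else 0)).Local v ×
      (cmDatum L 1 (Matrix.of fun i j : Fin 1 => if i.val + j.val + 1 = 1 then (1 : L) else 0)).Local v) ≃ₜ* ↥(Subgroup.centralizer ({ε} : Set ((cmDatum L 3 H').Local v))))
    (hy : y * ((endoEmbLocal L v εH).val : GL (Fin 3) (LocalRing L v)) * y⁻¹ = ε.val)
    (hθ : ∀ z : ((cmDatum L 2 (Matrix.of fun i j : Fin 2 => if i.val + j.val + 1 = 2 then (1 : L) else 0)).Local v ×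
      (cmDatum L 1 (Matrix.of fun i j : Fin 1 => if i.val + j.val + 1 = 1 then (1 : L) else 0)).Local v), (((θ z).1).val : GL (Fin 3) (LocalRing L v)) = y * ((endoEmbLocal L v z).val : GL (Fin 3) (LocalRing L v)) * y⁻¹)
    -- the bad class `ε′` (base point of its centraliser)
    (ε' : (cmDatum L 3 H').Local v) (εb' : ↥(Subgroup.centralizer ({ε'} : Set ((cmDatum L 3 H').Local v))))
    -- (SEP′) transported: `G′_v`-conjugate images of box points are `H_v`-conjugate
    (hsep' : ∃ B₇ ∈ 𝓝 εH, ∀ h ∈ B₇, ∀ h' ∈ B₇, ∀ x : (cmDatum L 3 H').Local v, x * ((θ h : ↥(Subgroup.centralizer ({ε} : Set ((cmDatum L 3 H').Local v)))) : (cmDatum L 3 H').Local v) * x⁻¹ = ((θ h' : ↥(Subgroup.centralizer ({ε} : Set ((cmDatum L 3 H').Local v)))) : (cmDatum L 3 H').Local v) → IsConj h h')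
    -- small boxes on the two sides share no `G′_v`-class
    (hdisj : ∃ B₀ ∈ 𝓝 εH, ∃ B₀' ∈ 𝓝 εb', ∀ h ∈ B₀, ∀ m' ∈ B₀', ∀ x : (cmDatum L 3 H').Local v, x * ((θ h : ↥(Subgroup.centralizer ({ε} : Set ((cmDatum L 3 H').Local v)))) : (cmDatum L 3 H').Local v) * x⁻¹ ≠ (m' : (cmDatum L 3 H').Local v))
    -- (U-s′) the SIDED uniform fibre near `ε_H`
    (hUs : ∀ B ∈ 𝓝 εH, ∀ B' ∈ 𝓝 εb', ∃ V ∈ 𝓝 εH, ∀ γH ∈ V, IsLocalGRegular L v γH → ∀ γ' : (cmDatum L 3 H').Local v, IsLocalNormPair L H' v γH γ' →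
      (∃ x : (cmDatum L 3 H').Local v, ∃ h ∈ B, IsLocalStablyConjH L v γH h ∧ x * γ' * x⁻¹ = ((θ h : ↥(Subgroup.centralizer ({ε} : Set ((cmDatum L 3 H').Local v)))) : (cmDatum L 3 H').Local v)) ∨
      (∃ x : (cmDatum L 3 H').Local v, ∃ m' ∈ B', x * γ' * x⁻¹ = (m' : (cmDatum L 3 H').Local v)))
    -- (D2ε) DESCENT of orbital integrals at `ε`, read on `H_v` through `θ`, for the canonical `mH`
    (hD : ∀ ψ : (cmDatum L 3 H').Local v → ℂ, IsLocSmooth ψ → ∃ B ∈ 𝓝 εH, ∃ ψε : ((cmDatum L 2 (Matrix.of fun i j : Fin 2 => if i.val + j.val + 1 = 2 then (1 : L) else 0)).Local v ×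
      (cmDatum L 1 (Matrix.of fun i j : Fin 1 => if i.val + j.val + 1 = 1 then (1 : L) else 0)).Local v) → ℂ, IsLocSmooth ψε ∧
      ∀ h ∈ B, IsLocalGRegular L v h → classOrbitalIntegral mG ψ (ConjClasses.mk ((θ h : ↥(Subgroup.centralizer ({ε} : Set ((cmDatum L 3 H').Local v)))) : (cmDatum L 3 H').Local v)) = classOrbitalIntegral mH ψε (ConjClasses.mk h))
    -- (σ-SAT) saturation at `ε_H`
    (hsat : ∀ V' ∈ 𝓝 εH, ∃ V ∈ 𝓝 εH, ∀ γH ∈ V, IsLocalGRegular L v γH → ∀ γH' : ((cmDatum L 2 (Matrix.of fun i j : Fin 2 => if i.val + j.val + 1 = 2 then (1 : L) else 0)).Local v ×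
      (cmDatum L 1 (Matrix.of fun i j : Fin 1 => if i.val + j.val + 1 = 1 then (1 : L) else 0)).Local v), IsLocalStablyConjH L v γH γH' → ∃ x : ((cmDatum L 2 (Matrix.of fun i j : Fin 2 => if i.val + j.val + 1 = 2 then (1 : L) else 0)).Local v ×
      (cmDatum L 1 (Matrix.of fun i j : Fin 1 => if i.val + j.val + 1 = 1 then (1 : L) else 0)).Local v), x * γH' * x⁻¹ ∈ V')
    -- (Iε′) the `ε′`-side is a local stable orbital integral (box shrinkable)
    (hI' : ∀ ψ : (cmDatum L 3 H').Local v → ℂ, IsLocSmooth ψ → ∀ B₀' ∈ 𝓝 εb', ∃ B' ∈ 𝓝 εb', B' ⊆ B₀' ∧ ∃ V ∈ 𝓝 εH, ∃ ψ' : ((cmDatum L 2 (Matrix.of fun i j : Fin 2 => if i.val + j.val + 1 = 2 then (1 : L) else 0)).Local v ×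
      (cmDatum L 1 (Matrix.of fun i j : Fin 1 => if i.val + j.val + 1 = 1 then (1 : L) else 0)).Local v) → ℂ, IsLocSmooth ψ' ∧
      ∀ γH ∈ V, IsLocalGRegular L v γH →
        (∑ᶠ c ∈ {c : ConjClasses ((cmDatum L 3 H').Local v) | ∃ x : (cmDatum L 3 H').Local v, ∃ m' ∈ B', x * Quotient.out c * x⁻¹ = (m' : (cmDatum L 3 H').Local v)},
          ((finExplicitCollection L H' μ hl hr) v).Δ γH (Quotient.out c) * classOrbitalIntegral mG ψ c) =
        stableOrbitalIntegralRel (IsLocalStablyConjH L v) mH ψ' γH)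
    (φ : (cmDatum L 3 H').Local v → ℂ) (hφ : IsLocSmooth φ) :
    ∃ V ∈ 𝓝 εH, ∃ φH : ((cmDatum L 2 (Matrix.of fun i j : Fin 2 => if i.val + j.val + 1 = 2 then (1 : L) else 0)).Local v ×
      (cmDatum L 1 (Matrix.of fun i j : Fin 1 => if i.val + j.val + 1 = 1 then (1 : L) else 0)).Local v) → ℂ, IsLocSmooth φH ∧ ∀ γH ∈ V, IsLocalGRegular L v γH →
      stableOrbitalIntegralRel (IsLocalStablyConjH L v) mH φH γH =
        ∑ᶠ c : ConjClasses ((cmDatum L 3 H').Local v), ((finExplicitCollection L H' μ hl hr) v).Δ γH (Quotient.out c) * classOrbitalIntegral mG φ c := by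
  classical
  have hΔT : ∀ (a' : ((cmDatum L 2 (Matrix.of fun i j : Fin 2 => if i.val + j.val + 1 = 2 then (1 : L) else 0)).Local v ×
      (cmDatum L 1 (Matrix.of fun i j : Fin 1 => if i.val + j.val + 1 = 1 then (1 : L) else 0)).Local v)) (b : (cmDatum L 3 H').Local v), ((finExplicitCollection L H' μ hl hr) v).Δ a' b = finExplicitDelta L v H' a' μ b :=
    fun a' b => finExplicitCollection_Δ L H' μ hl hr v a' b
  -- matching at the base and along the dock
  have hε : IsLocalNormPair L H' v εH ε := isConj_iff.2 ⟨y, hy⟩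
  have hθm : ∀ h : ((cmDatum L 2 (Matrix.of fun i j : Fin 2 => if i.val + j.val + 1 = 2 then (1 : L) else 0)).Local v ×
      (cmDatum L 1 (Matrix.of fun i j : Fin 1 => if i.val + j.val + 1 = 1 then (1 : L) else 0)).Local v), IsLocalNormPair L H' v h ((θ h : ↥(Subgroup.centralizer ({ε} : Set ((cmDatum L 3 H').Local v)))) : (cmDatum L 3 H').Local v) := fun h => isConj_iff.2 ⟨y, (hθ h).symm⟩
  have hθε : ((θ εH : ↥(Subgroup.centralizer ({ε} : Set ((cmDatum L 3 H').Local v)))) : (cmDatum L 3 H').Local v) = ε := Subtype.ext (by rw [hθ εH]; exact hy)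
  -- `Δ‴` is eventually constant near `(ε_H, ε)`
  have hΔev := finExplicitDelta_eventually_eq L v H' hH' hdet' μ hε (isUnit_eval_finCharpolyTwo_of_central L v w hw εH a ha hu)
  obtain ⟨VΔ, hVΔ, OΔ, hOΔ, hΔ⟩ := mem_nhds_prod_iff.1 hΔev
  -- descent, separation, disjointness
  obtain ⟨B₄, hB₄, φε, hφε, hdesc⟩ := hD φ hφ
  obtain ⟨B₇, hB₇, hsep⟩ := hsep'
  obtain ⟨B₀, hB₀, B₀', hB₀', hdj⟩ := hdisj
  -- the ε-side box in `H_v`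
  have hθc : Continuous (fun h : ((cmDatum L 2 (Matrix.of fun i j : Fin 2 => if i.val + j.val + 1 = 2 then (1 : L) else 0)).Local v ×
      (cmDatum L 1 (Matrix.of fun i j : Fin 1 => if i.val + j.val + 1 = 1 then (1 : L) else 0)).Local v) => ((θ h : ↥(Subgroup.centralizer ({ε} : Set ((cmDatum L 3 H').Local v)))) : (cmDatum L 3 H').Local v)) := continuous_subtype_val.comp θ.continuous
  have hOΔ' : OΔ ∈ 𝓝 ((fun h : ((cmDatum L 2 (Matrix.of fun i j : Fin 2 => if i.val + j.val + 1 = 2 then (1 : L) else 0)).Local v ×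
      (cmDatum L 1 (Matrix.of fun i j : Fin 1 => if i.val + j.val + 1 = 1 then (1 : L) else 0)).Local v) => ((θ h : ↥(Subgroup.centralizer ({ε} : Set ((cmDatum L 3 H').Local v)))) : (cmDatum L 3 H').Local v)) εH) := by
    rw [show (fun h : ((cmDatum L 2 (Matrix.of fun i j : Fin 2 => if i.val + j.val + 1 = 2 then (1 : L) else 0)).Local v ×
      (cmDatum L 1 (Matrix.of fun i j : Fin 1 => if i.val + j.val + 1 = 1 then (1 : L) else 0)).Local v) => ((θ h : ↥(Subgroup.centralizer ({ε} : Set ((cmDatum L 3 H').Local v)))) : (cmDatum L 3 H').Local v)) εH = ε from hθε]; exact hOΔ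
  have hθO : (fun h : ((cmDatum L 2 (Matrix.of fun i j : Fin 2 => if i.val + j.val + 1 = 2 then (1 : L) else 0)).Local v ×
      (cmDatum L 1 (Matrix.of fun i j : Fin 1 => if i.val + j.val + 1 = 1 then (1 : L) else 0)).Local v) => ((θ h : ↥(Subgroup.centralizer ({ε} : Set ((cmDatum L 3 H').Local v)))) : (cmDatum L 3 H').Local v)) ⁻¹' OΔ ∈ 𝓝 εH := hθc.continuousAt.preimage_mem_nhds hOΔ'
  set B : Set ((cmDatum L 2 (Matrix.of fun i j : Fin 2 => if i.val + j.val + 1 = 2 then (1 : L) else 0)).Local v ×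
      (cmDatum L 1 (Matrix.of fun i j : Fin 1 => if i.val + j.val + 1 = 1 then (1 : L) else 0)).Local v) := B₄ ∩ B₇ ∩ B₀ ∩ (fun h : ((cmDatum L 2 (Matrix.of fun i j : Fin 2 => if i.val + j.val + 1 = 2 then (1 : L) else 0)).Local v ×
      (cmDatum L 1 (Matrix.of fun i j : Fin 1 => if i.val + j.val + 1 = 1 then (1 : L) else 0)).Local v) => ((θ h : ↥(Subgroup.centralizer ({ε} : Set ((cmDatum L 3 H').Local v)))) : (cmDatum L 3 H').Local v)) ⁻¹' OΔ with hBdef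
  have hB : B ∈ 𝓝 εH := inter_mem (inter_mem (inter_mem hB₄ hB₇) hB₀) hθO
  -- the ε′-side (Iε′) inside `B₀′`, the sided fibre, saturation into `B`
  obtain ⟨B', hB', hB'sub, V₆, hV₆, ψ', hψ', hI⟩ := hI' φ hφ B₀' hB₀'
  obtain ⟨V₃, hV₃, hside⟩ := hUs B hB B' hB'
  obtain ⟨V₅, hV₅, hsatB⟩ := hsat B hB
  -- the transfer near `ε_H`
  set Δ₀ : ℂ := finExplicitDelta L v H' εH μ ε with hΔ₀
  have hsm : IsLocSmooth (Δ₀ • φε) :=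
    (isLocSmooth_iff _).2 ⟨hφε.isLocallyConstant.comp fun z => Δ₀ * z, hφε.hasCompactSupport.mul_left⟩
  refine ⟨V₃ ∩ V₅ ∩ V₆ ∩ VΔ, inter_mem (inter_mem (inter_mem hV₃ hV₅) hV₆) hVΔ, Δ₀ • φε + ψ', hsm.add hψ', ?_⟩
  rintro γH ⟨⟨⟨hγ₃, hγ₅⟩, hγ₆⟩, hγΔ⟩ hγreg
  -- the summand and the two side predicates
  set F : ConjClasses ((cmDatum L 3 H').Local v) → ℂ := fun c =>
    ((finExplicitCollection L H' μ hl hr) v).Δ γH (Quotient.out c) * classOrbitalIntegral mG φ c with hFdef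
  set Pε : ConjClasses ((cmDatum L 3 H').Local v) → Prop := fun c =>
    ∃ x : (cmDatum L 3 H').Local v, ∃ h ∈ B, IsLocalStablyConjH L v γH h ∧ x * Quotient.out c * x⁻¹ = ((θ h : ↥(Subgroup.centralizer ({ε} : Set ((cmDatum L 3 H').Local v)))) : (cmDatum L 3 H').Local v) with hPεdef
  set Pε' : ConjClasses ((cmDatum L 3 H').Local v) → Prop := fun c => ∃ x : (cmDatum L 3 H').Local v, ∃ m' ∈ B', x * Quotient.out c * x⁻¹ = (m' : (cmDatum L 3 H').Local v) with hPε'def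
  have hFfin : (Function.support F).Finite :=
    finite_support_delta_mul_classOrbitalIntegral_of_isLocSmooth L H' v hH' hdet' _ mG φ hφ γH hγreg
  -- (1) split `F = 1_{Pε}·F + 1_{Pε′}·F` (the sided uniform fibre + disjointness; unmatched classes carry `Δ = 0`)
  have hsplit : ∀ c, F c = (if Pε c then F c else 0) + (if Pε' c then F c else 0) := by
    intro c
    by_cases hR : IsLocalNormPair L H' v γH (Quotient.out c)
    · rcases hside γH hγ₃ hγreg _ hR with ⟨x, h, hhB, hst, hx⟩ | ⟨x, m', hm', hx⟩
      · have hP : Pε c := ⟨x, h, hhB, hst, hx⟩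
        have hnP : ¬ Pε' c := by
          rintro ⟨x', m'', hm'', hx'⟩
          refine hdj h hhB.1.2 m'' (hB'sub hm'') (x' * x⁻¹) ?_
          rw [← hx, ← hx']; group
        rw [if_pos hP, if_neg hnP, add_zero]
      · have hP : Pε' c := ⟨x, m', hm', hx⟩
        have hnP : ¬ Pε c := by
          rintro ⟨x', h, hhB, -, hx'⟩
          refine hdj h hhB.1.2 m' (hB'sub hm') (x * x'⁻¹) ?_
          rw [← hx', ← hx]; group
        rw [if_neg hnP, if_pos hP, zero_add]
    · have hF0 : F c = 0 := by
        simp only [hFdef, hΔT, finExplicitDelta_of_not_isLocalNormPair L v H' γH μ hR, zero_mul]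
      simp only [hF0, ite_self, add_zero]
  have hfin₁ : (Function.support fun c => if Pε c then F c else 0).Finite :=
    hFfin.subset fun c hc => by
      simp only [Function.mem_support, ne_eq, ite_eq_right_iff, Classical.not_imp] at hc ⊢
      exact hc.2
  have hfin₂ : (Function.support fun c => if Pε' c then F c else 0).Finite :=
    hFfin.subset fun c hc => by
      simp only [Function.mem_support, ne_eq, ite_eq_right_iff, Classical.not_imp] at hc ⊢
      exact hc.2
  have hsum : (∑ᶠ c, F c) = (∑ᶠ c, if Pε c then F c else 0) + ∑ᶠ c, if Pε' c then F c else 0 := by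
    rw [← finsum_add_distrib hfin₁ hfin₂]
    exact finsum_congr hsplit
  have hite : ∀ P : ConjClasses ((cmDatum L 3 H').Local v) → Prop, (∑ᶠ c, if P c then F c else 0) = ∑ᶠ c ∈ {c | P c}, F c := by
    intro P
    rw [finsum_mem_def]
    exact finsum_congr fun c => (Set.indicator_apply _ _ _).symm
  -- (2) the ε′-side is `Φ^st(γ_H, ψ′)` by (Iε′)
  have hε'side : (∑ᶠ c, if Pε' c then F c else 0) = stableOrbitalIntegralRel (IsLocalStablyConjH L v) mH ψ' γH := by
    rw [hite]; exact hI γH hγ₆ hγreg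
  -- (3) the ε-side is `Δ₀ · Φ^st(γ_H, φ_ε)` (the bookkeeping lemma above)
  have hregB : ∀ h, IsLocalStablyConjH L v γH h → IsLocalGRegular L v h := fun h hst => isGRegular_of_isStablyConjH _ _ _ _ hst hγreg
  have hRθ : ∀ h, IsLocalStablyConjH L v γH h → IsLocalNormPair L H' v γH ((θ h : ↥(Subgroup.centralizer ({ε} : Set ((cmDatum L 3 H').Local v)))) : (cmDatum L 3 H').Local v) :=
    fun h hst => (isLocalNormPair_iff_of_isLocalStablyConjH L v H' hst _).1 (hθm h)
  have hΔθ : ∀ h ∈ B, IsLocalStablyConjH L v γH h → finExplicitDelta L v H' γH μ ((θ h : ↥(Subgroup.centralizer ({ε} : Set ((cmDatum L 3 H').Local v)))) : (cmDatum L 3 H').Local v) = Δ₀ := by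
    intro h hhB hst
    have hmem : (γH, ((θ h : ↥(Subgroup.centralizer ({ε} : Set ((cmDatum L 3 H').Local v)))) : (cmDatum L 3 H').Local v)) ∈ VΔ ×ˢ OΔ := Set.mk_mem_prod hγΔ hhB.2
    have hq := hΔ hmem
    simp only [Set.mem_setOf_eq] at hq
    rw [hΔ₀]
    exact hq (hRθ h hst)
  have hεside : (∑ᶠ c, if Pε c then F c else 0) = Δ₀ * stableOrbitalIntegralRel (IsLocalStablyConjH L v) mH φε γH := by
    rw [hite]
    exact finsum_mem_side_eq_mul_stableOrbitalIntegralRel L H' v μ hl hr mH mG θ γH B φ φε Δ₀ (hsatB γH hγ₅ hγreg)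
      (fun h hh h' hh' x hx => hsep h hh.1.1.2 h' hh'.1.1.2 x hx) hΔθ
      (fun h hhB hst => hdesc h hhB.1.1.1 (hregB h hst))
  -- (4) assemble: `Φ^st(γ_H, Δ₀ • φ_ε + ψ′) = Δ₀ Φ^st(γ_H, φ_ε) + Φ^st(γ_H, ψ′)`
  rw [hsum, hεside, hε'side, ← stableOrbitalIntegralRel_smul_fun]
  exact localStableOrbitalIntegralH_add_of_isLocSmooth L v (OrbitalMeasureFamily.IsCanonical.isAdmissibleOn hmH)
    γH hγreg _ _ hsm hψ'

end CentralSingular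

end Literature.NumberTheory.Rogawski1990

end
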